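import Mathlib
import HarnessLib
import Literature.MathematicalPhysics.StatisticalMechanics.TunedInitialConditionTorusFRD
import Literature.MathematicalPhysics.StatisticalMechanics.TuningLipschitzSTorusFRD

/-!
# [ABKM19] Lemma 12.6 for the torus data, UNCONDITIONAL: the tuned initial relevant Hamiltonian
# `ℋ⋆ = Π_{H_0} Ẑ(𝒦, ℋ⋆)` exists

`TunedInitialConditionTorusFRD.exists_tuned_initial_of_torusFRD` assembles Lemma 12.6 for the torus data
from Theorem 6.8 (`RGStepABKMQ`), (12.51)–(12.52) (`TuningLipschitzTorusFRD`), Lemma 12.2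
(`InitialActivityHamiltonianBundled`) and Brouwer's theorem, CONDITIONALLY on hypothesis (12.53) for
`S_k` (`hl`).  `TuningLipschitzSTorusFRD.exists_activityNormLE_rgSQ_sub_of_torusFRD` proves (12.53) in
exactly that shape (volume-dependent constant, which Brouwer tolerates).  This file composes the two:

* **`exists_tuned_initial_of_torusFRD'`** — under the hypotheses of Theorem 6.8 (uniformly in the tuning
  parameter), the contraction regime of Ch. 12, a small initial perturbation `𝒦` and a Lipschitz tuning
  map `qmap`, there is `ℋ⋆`, `‖ℋ⋆‖ ≤ ρ`, and a tuned relevant trajectory of the system `q = qmap ℋ⋆`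
  started from `K̂_0(𝒦, ℋ⋆)`, in the `ε`-tube, with `x_0 = ℋ⋆` — no hypothesis on `S_k` left.

Honest scope: this is the fine tuning (Lemma 12.6) only; the representation of `𝒵_N` (Ch. 4) and the
reality of the tuned quadratic form on the `ι`-symmetric class are not here.  Everything is proved; no
named fact.

## References
* S. Adams, S. Buchholz, R. Kotecký, S. Müller, arXiv:1910.13564, Lemma 12.6, Theorem 6.8, Lemma 12.2
  [AdamsBuchholzKoteckyMuller2019].
-/

noncomputable section

namespace Literature.MathematicalPhysics.StatisticalMechanics.GradientRG

open scoped BigOperators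
open Real Set Finset MeasureTheory
open Literature.MathematicalPhysics.StatisticalMechanics.GradientFRD
  (fourierCoeff cExt cExt_of_mem IsElliptic IsUnitSymm InShell iterDiff supNorm conv ellOp isElliptic_one)
open Literature.MathematicalPhysics.StatisticalMechanics.TorusPolymer (IsPolymer numBlocks blockOf boxCorner)
open Literature.Barriers.CriticalPhenomena.LongRangePhi4.Polymer (IsConn)
open Literature.MathematicalPhysics.QuantumFieldTheory
open Literature.Dynamics.Hyperbolic

variable {d M : ℕ} [NeZero M]

section Package

variable {L N Mord R n ñ : ℕ} {θbar lam μ δ₁ δ₀ A𝒫 : ℝ}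
    {𝒞 : Matrix (Fin d) (Fin d) ℝ → ℕ → (Fin d → ZMod M) → ℝ} {Mc : ℕ → ℝ}
    {Cα : (Fin d → ℕ) → ℕ → ℝ} {c C : ℝ} {Cℓ : ℕ → ℝ}

set_option maxHeartbeats 800000 in
/-- **[ABKM19] Lemma 12.6 for the torus data, unconditional** (module docstring).
[cite: AdamsBuchholzKoteckyMuller2019, Lemma 12.6] -/
theorem exists_tuned_initial_of_torusFRD' {h : ℝ} [Fact (0 < h)] [Fact (0 < L)]
    (hd : 3 ≤ d) (hMord : 1 ≤ Mord) (hMR : Mord ≤ R) (hLodd : Odd L) (hL : 2 ^ (d + 3) + 16 * R ≤ L)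
    (hR2 : 2 ≤ R) (hM : M = L ^ N)
    (hθbar : 0 < θbar) (hlam : 0 < lam) (hn : 2 * Mord ≤ n) (hn2 : 2 ≤ n) (hnñ : n ≤ ñ)
    (hc : 0 < c) (hC1 : 0 ≤ Cℓ 1)
    (hallA : ∀ A : Matrix (Fin d) (Fin d) ℝ, IsElliptic (1 / 2 : ℝ) 2 A →
        (∀ k, 1 ≤ k → k ≤ N + 1 →
          ∑ x : Fin d → ZMod M, 𝒞 A k x = 0 ∧ ∀ x, 𝒞 A k (-x) = 𝒞 A k x) ∧
        (∀ k, 1 ≤ k → k ≤ N + 1 → ∀ φ : (Fin d → ZMod M) → ℝ, ∑ x, φ x = 0 →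
          0 ≤ ∑ x, ∑ y, φ x * 𝒞 A k (x - y) * φ y) ∧
        (∀ φ : (Fin d → ZMod M) → ℝ, ∑ x, φ x = 0 →
          ellOp A (conv (fun x => ∑ k ∈ Finset.Icc 1 (N + 1), 𝒞 A k x) φ) = φ) ∧
        (∀ k, 1 ≤ k → k ≤ N → Mc k ≤ 0 ∧
          ∀ x : Fin d → ZMod M, ((L : ℝ) ^ k) / 2 ≤ (supNorm x : ℝ) →
            𝒞 A k x = Mc k) ∧
        (∀ k, 1 ≤ k → k ≤ N + 1 → ∀ B : Matrix (Fin d) (Fin d) ℝ, IsUnitSymm B →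
          (∃ ε : ℝ, 0 < ε ∧ ∀ x : Fin d → ZMod M,
            ContDiffOn ℝ ⊤ (fun s : ℝ => 𝒞 (A + s • B) k x) (Set.Ioo (-ε) ε)) ∧
          ∀ α : Fin d → ℕ, ∑ i, α i ≤ n → ∀ ℓ : ℕ, ∀ x : Fin d → ZMod M,
            abs (iteratedDeriv ℓ (fun s : ℝ => iterDiff α (𝒞 (A + s • B) k) x) 0)
              ≤ Cα α ℓ / (L : ℝ) ^ ((k - 1) * (d - 2 + ∑ i, α i))) ∧
        (∀ k, 1 ≤ k → k ≤ N + 1 → ∀ j : ℕ, ∀ κ : Fin d → ZMod M, κ ≠ 0 → InShell L j κ →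
          (j < k →
            c / (L : ℝ) ^ (2 * (d + ñ) + 1) * (L : ℝ) ^ (2 * j)
                / (L : ℝ) ^ ((k - j) * (d - 1 + n)) ≤ (fourierCoeff (𝒞 A k) κ).re ∧
            ‖fourierCoeff (𝒞 A k) κ‖
              ≤ C * (L : ℝ) ^ (2 * (d + ñ) + 1) * (L : ℝ) ^ (2 * j)
                  / (L : ℝ) ^ ((k - j) * (d - 1 + n))) ∧
          (k ≤ j →
            c / (L : ℝ) ^ (2 * (d + ñ) + 1) * (L : ℝ) ^ (2 * k)
                ≤ (fourierCoeff (𝒞 A k) κ).re ∧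
            ‖fourierCoeff (𝒞 A k) κ‖ ≤ C * (L : ℝ) ^ (2 * k)) ∧
          ∀ B : Matrix (Fin d) (Fin d) ℝ, IsUnitSymm B → ∀ ℓ : ℕ, 1 ≤ ℓ →
            (j < k →
              ‖iteratedDeriv ℓ (fun s : ℝ => fourierCoeff (𝒞 (A + s • B) k) κ) 0‖
                ≤ Cℓ ℓ * (L : ℝ) ^ (2 * (d + ñ) + 1) * (L : ℝ) ^ (2 * j)
                    / (L : ℝ) ^ ((k - j) * (d - 1 + ñ))) ∧
            (k ≤ j →
              ‖iteratedDeriv ℓ (fun s : ℝ => fourierCoeff (𝒞 (A + s • B) k) κ) 0‖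
                ≤ Cℓ ℓ * (L : ℝ) ^ (2 * k))))
    (hB : AbkmWeightBounds L N Mord R n θbar lam μ δ₁ δ₀ A𝒫 (fun j => 𝒞 1 j)
      (abkmWeightData L N Mord R θbar (schedDelta δ₀ δ₁ N) fun j => 𝒞 1 j))
    {pT r₀ : ℕ} (hp : d / 2 + 2 ≤ pT) (hpM : pT + d ≤ Mord) (hr₀ : 3 ≤ r₀)
    (hδ₀ : 0 < δ₀) (hδ₁ : 0 < δ₁) (hh0 : hZeroSq d R δ₀ δ₁ ≤ h ^ 2)
    (hh2 : secondDiffConst (fun θ' => Cα θ' 0) ≤ h ^ 2)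
    -- the tuning ball
    {θ : ℝ} (hθ0 : 0 ≤ θ) (hθ : θ < θbar)
    {T₀ : ℝ} (hT₀ : T₀ ≤ 1 / 2) (hKT₀ : shellRatioConst c (Cℓ 1) (L : ℝ) d ñ * T₀ ≤ Real.log (1 + θ))
    {A𝒫' : ℝ} (hA𝒫' : weightIntConstRho θbar θ (traceConst d Mord R lam (derivSum d n fun θ' _ => Cα θ' 0)) = A𝒫')
    -- the side conditions of Theorem 6.8 (`RGStepABKMQ`), at `A_𝒫' = A_𝒫(θ)`
    {A : ℝ} (hA1 : 1 ≤ A) (hA𝒫A : A𝒫' ≤ A)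
    (hsmall : (2 : ℝ) ^ (L ^ d) * (A𝒫' * A ^ (-(1 - (1 + 1 / ((2 * (2 ^ d + 1) + 6 : ℝ) ^ d))⁻¹) : ℝ)) ≤ 1)
    {r : ℝ} (hr0 : 0 ≤ r) (hr : r ≤ 1 / 64)
    (hv : vABKM d R A A𝒫' r ≤ 1 / 64) (hωA : omegaABKM d R A A𝒫' r * A ^ 2 ≤ 1)
    (hc3A : (kappaABKM d R A A𝒫' r) ^ (L ^ d) * ((2 * (2 * (kappaABKM d R A A𝒫' r) * max 1 A𝒫')) ^ ((2 ^ (d + 1) + 2) ^ d * L ^ d) * (4 : ℝ) ^ ((2 ^ (d + 1) + 2) ^ d * L ^ d)) ≤ A ^ ((1 + 1 / ((2 * (2 ^ d + 1) + 6 : ℝ) ^ d)) - 1 : ℝ))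
    (hc2A : (kappaABKM d R A A𝒫' r) ^ (L ^ d) * ((2 * (kappaABKM d R A A𝒫' r) * max 1 A𝒫') ^ ((2 ^ (d + 1) + 2) ^ d * L ^ d) * (2 : ℝ) ^ ((2 ^ (d + 1) + 2) ^ d * L ^ d)) ≤ A ^ ((1 + 1 / ((2 * (2 ^ d + 1) + 6 : ℝ) ^ d)) - 1 : ℝ))
    -- the contraction regime of Ch. 12
    {η κ ε ρ : ℝ} (hη : 0 < η) (hη1 : η ≤ 1)
    (hκ₁ : (3 / 4 : ℝ) * (η + (L : ℝ) ^ d * (pi2BoundConst d (((2 * R + 2 : ℕ) : ℝ) + ((d / 2 + 1 : ℕ) : ℝ)) * (A𝒫' * A⁻¹))) ≤ κ)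
    (hκ₂ : sigmaABKM d L R A A𝒫' r ≤ κ * η) (hκ : κ < 1)
    (hε : 0 ≤ ε) (hεr : ε ≤ r) (hερ : ε ≤ ρ) (hρ16 : ρ ≤ 1 / 16)
    -- the initial perturbation
    {𝒦 : (Fin d → ℝ) → ℂ} {ρ𝒦 : ℝ} (h𝒦 : ContDiff ℝ r₀ 𝒦)
    (h𝒦b : ∀ s, s ≤ r₀ → ∀ z : Fin d → ℝ, ‖iteratedFDeriv ℝ s 𝒦 z‖ ≤ ρ𝒦 * Real.exp ((∑ i, z i ^ 2) / 4))
    (h𝒦small : (Real.exp (1 / 4) + 2 * Real.exp (3 / 8)) *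
      (ρ𝒦 * Real.exp (fieldWt h (L : ℝ) d 0 / (L : ℝ) ^ 0)) * A ≤ 1 / 2)
    (h𝒦ε : Real.exp (1 / 4) * (ρ𝒦 * Real.exp (fieldWt h (L : ℝ) d 0 / (L : ℝ) ^ 0)) * A ≤ ε)
    -- the tuning map
    (qmap : HamSpace ℂ d (fieldWt h (L : ℝ) d 0) ((L : ℝ) ^ 0) (L ^ (d * 0)) → Matrix (Fin d) (Fin d) ℝ)
    (hqsymm : ∀ x, (qmap x).IsSymm) (hqT : ∀ x, ∑ i, ∑ j, |qmap x i j| ≤ T₀)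
    {Lq : ℝ} (hLq : 0 ≤ Lq)
    (hqlip : ∀ x x', ‖x‖ ≤ ρ → ‖x'‖ ≤ ρ → ∑ i, ∑ j, |(qmap x - qmap x') i j| ≤ Lq * ‖x - x'‖) :
    ∃ x₀ : HamSpace ℂ d (fieldWt h (L : ℝ) d 0) ((L : ℝ) ^ 0) (L ^ (d * 0)), ‖x₀‖ ≤ ρ ∧
      ∃ x : ∀ k, HamSpace ℂ d (fieldWt h (L : ℝ) d k) ((L : ℝ) ^ k) (L ^ (d * k)),
        RGFlow.IsTunedQ (E := fun k => HamSpace ℂ d (fieldWt h (L : ℝ) d k) ((L : ℝ) ^ k) (L ^ (d * k)))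
            (F := fun k => activitySpace (abkmNormParams L N Mord R pT r₀ h θbar A (schedDelta δ₀ δ₁ N) fun j => 𝒞 1 j) k)
            N (rgA L h (fun j => 𝒞 ((1 : Matrix (Fin d) (Fin d) ℝ) + qmap x₀) j))
            (rgBT hd hMord hMR hLodd hL hM hθbar hlam hn hn2 hnñ hc hC1 hallA hB pT r₀ hr₀ A hθ0 hθ hT₀ hKT₀ (qmap x₀))
            (rgSQ (L := L) (N := N) (Mord := Mord) (R := R) (p := pT) (r₀ := r₀) (h := h) (θbar := θbar) (A := A)
              (δ₀ := δ₀) (δ₁ := δ₁) (𝒞 := fun j => 𝒞 1 j) (fun j => 𝒞 ((1 : Matrix (Fin d) (Fin d) ℝ) + qmap x₀) j))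
            (initAct (N := N) (Mord := Mord) (R := R) (p := pT) (r₀ := r₀) (θbar := θbar) (A := A) (δ₀ := δ₀)
              (δ₁ := δ₁) (𝒞 := fun j => 𝒞 1 j) 𝒦 x₀) x ∧
          RGFlow.InTubeQ (E := fun k => HamSpace ℂ d (fieldWt h (L : ℝ) d k) ((L : ℝ) ^ k) (L ^ (d * k)))
            (F := fun k => activitySpace (abkmNormParams L N Mord R pT r₀ h θbar A (schedDelta δ₀ δ₁ N) fun j => 𝒞 1 j) k)
            N η ε (activityNormLE (abkmNormParams L N Mord R pT r₀ h θbar A (schedDelta δ₀ δ₁ N) fun j => 𝒞 1 j))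
            (rgSQ (L := L) (N := N) (Mord := Mord) (R := R) (p := pT) (r₀ := r₀) (h := h) (θbar := θbar) (A := A)
              (δ₀ := δ₀) (δ₁ := δ₁) (𝒞 := fun j => 𝒞 1 j) (fun j => 𝒞 ((1 : Matrix (Fin d) (Fin d) ℝ) + qmap x₀) j))
            (initAct (N := N) (Mord := Mord) (R := R) (p := pT) (r₀ := r₀) (θbar := θbar) (A := A) (δ₀ := δ₀)
              (δ₁ := δ₁) (𝒞 := fun j => 𝒞 1 j) 𝒦 x₀) x ∧
          x 0 = x₀ := by
  obtain ⟨lT, hlT, hl⟩ := exists_activityNormLE_rgSQ_sub_of_torusFRD (h := h) hd hMord hMR hLodd hL hR2 hM hθbar hlam hn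
    hn2 hnñ hc hC1 hallA hB hp hpM hr₀ hδ₀ hδ₁ hh0 hh2 hθ0 hθ hT₀ hKT₀ hA𝒫' hA1 hA𝒫A hsmall hr0 hr hv hωA hc3A hc2A
  exact exists_tuned_initial_of_torusFRD hd hMord hMR hLodd hL hR2 hM hθbar hlam hn hn2 hnñ hc hC1 hallA hB hp hpM hr₀
    hδ₀ hδ₁ hh0 hh2 hθ0 hθ hT₀ hKT₀ hA𝒫' hA1 hA𝒫A hsmall hr0 hr hv hωA hc3A hc2A hη hη1 hκ₁ hκ₂ hκ hε hεr hερ hρ16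
    h𝒦 h𝒦b h𝒦small h𝒦ε qmap hqsymm hqT hLq hqlip hlT hl

end Package

end Literature.MathematicalPhysics.StatisticalMechanics.GradientRG

end
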